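import Mathlib
import HarnessLib
import HarnessLib.Audit
import Summits.AtomisticToContinuum.Statement
import Literature.MathematicalPhysics.QuantumManyBody.PeriodicBoseGas

/-!
Route: BECImpurityMassFlow

CLOSED (retired) 2026-08-15T13:39:02Z by operator:999:1257524 — reason: not-a-thesis: assembly does not conclude the sub-problem Statement — note: D-0027 §2.1 audit (human 2026-08-15: routes that do not decide the summit are removed): the assembly concludes `Literature.MathematicalPhysics.QuantumManyBody.BoseGas.BoseEinsteinCondensation`, not the sub-problem statement; a NEW conforming route may be opened from the same idea (generated `closes . The file is kept as the record of this route; refuted decls are indexed as negative knowledge (`ledger negatives`).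

# Route BECImpurityMassFlow — pin a scatterer, then give it the boson mass — torus BEC from no
static orthogonality catastrophe plus an ε-recoil bridge

It suffices to show X = StaticNoCatastrophe ∧ RecoilBridge, two statements about the dilute PERIODIC
Bose gas with one distinguished
particle, realising card static-impurity-mass-flow (spine) with its second crux restated as a
smallness statement (novelty audit-15).
Deform the mass M of one tagged particle coupled to the others by the same v: at M = m the absolute
ground state is the symmetric one
(Perron–Frobenius), and the box average of the tagged affinity A^(m)(x,y) = γ(x,y)/ρ IS the
constant-mode fraction n₀/N; at M = ∞ the
tagged affinity is the overlap ⟨χ^x,χ^y⟩ of ground states of the N-boson bath with a PINNED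
scatterer at x resp. y — Anderson's object,
the characteristic function of the dressing cloud's total momentum. (S1) StaticNoCatastrophe: for
every repulsive finite-range v and
ε > 0, at all small densities and for all large N, δ-near-minimisers of the two pinned-scatterer
energies overlap ≥ 1 − ε, uniformly in
x, y (no catastrophe AND asymptotic completeness; a pure bath statement — no Bose symmetry of the
probe, no Palm measures, a one-body tilt).
(B) RecoilBridge: whatever uniform floor c the static overlaps have at (N, ρ, δ), every
δ-near-minimiser of the (N+1)-boson periodic
energy on the same torus has ⟨Ψ, n₀Ψ⟩ ≥ (c − ε)(N+1): recoil costs at most ε at low density. S1 ∧ B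
give n₀ ≥ N/2 on the torus of
side (N/ρ)^{1/3}, i.e. the shared target PeriodicBEC (stmt-0826, glue StaticFloorCondenses), and the
shared transfer BoundaryTransferWeak
(stmt-0827) yields the Dirichlet, mode-free conjunct.
Lean: `StaticNoCatastrophe ∧ RecoilBridge` — decls of this route, each a one-line Prop over
Literature.MathematicalPhysics.QuantumManyBody.BoseGas.{IsRepulsiveFiniteRange, Space,
PeriodicTrialState, periodicEnergy, periodicGroundStateEnergy, periodizedPotential, cellN,
sideLength, condensateOccupation, HasGroundStateBEC, BoseEinsteinCondensation} written out under
Cruxes (rc 0 in Sketch.lean, assembly term included)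

## Assembly
Pure logic (term in Sketch.lean: `fun h1 h2 h3 h4 v hv => h4 v hv (h3 h1 h2 v hv)`): the glue
StaticFloorCondenses turns the two torus
cruxes into PeriodicBEC (= ∀ v, IsRepulsiveFiniteRange v → the stmt-0826 body), BoundaryTransferWeak
consumes that body per potential and
returns ∃ρ₀ ∀ρ∈(0,ρ₀) HasGroundStateBEC v ρ, which is the conjunct
Literature.MathematicalPhysics.QuantumManyBody.BoseGas.BoseEinsteinCondensation
(= Summits' abbrev BoseEinsteinCondensation) after introducing v.

Rationale: WHY THIS LINE. The card's dial is the PROBE MASS, an axis no route uses: at M = ∞ the many-body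
question collapses to the fidelity of two ground states of
the SAME bath differing by a relocated one-body potential, where orthogonality-catastrophe
technology lives (Anderson1967; rigorous
fermionic theory GebertKuttlerMuller2014 = arXiv:1302.6124; Bose-polaron physics
AstrakharchikPitaevskii2004, ShchadilovaEtAl2016,
GuentherEtAl2021 = arXiv:2004.07166, whose eq. (3) shows the IDEAL gas has a stretched-exponential
bosonic catastrophe while eq. (14)
gives a finite log Z = −√2πnξb² once the bosons repel), and the return to M = m is an ε-closeness
statement between two variational
problems on one torus rather than a monotonicity (the 1-D exact/variational results Castella1996,
RoschKopp1995, Mcguire1965 forbid a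
comparison principle but are consistent with the endpoint inequality). Imported area:
impurity/orthogonality physics of condensed matter
(fidelity of ground states under a local tilt, fidelity susceptibility = second negative moment of
the density spectral function, IR-finite
in d = 3 exactly because S(k) ≲ k/2c) with an explicit dictionary (tagged boson ↦ impurity of mass
M; n₀/N ↦ box-averaged affinity;
ODLRO at M = ∞ ↦ atom at zero cloud momentum). What it does that the open routes do not:
BECPeriodicReduction/BECPinning/BECInfraredBound/
BECRenormGroup attack n₀ of the symmetric state head-on; here half of the difficulty (S1) is moved
to a statement with NO permutation
symmetry and no condensate in its formulation, checkable by QMC and killable by a single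
static-impurity computation, and the other half
(B) is a comparison between neighbouring Hamiltonians; the negatives index is empty, and the sibling
cards kv-insertion-corrector /
one-particle-at-a-time keep recoil throughout (their own text calls the static end 'the hard
envelope'), so this is the complementary bet.

RANKED CRUXES. #0 PeriodicBEC (target) — the shared torus target = route BECPeriodicReduction's crux
PeriodicBEC (stmt-0826), verbatim: for every repulsive finite-range v there is ρ₀>0 such that for
0<ρ<ρ₀ there is c>0 with: for all large N there is δ>0 such that every periodic trial state on the
torus of side (N/ρ)^{1/3} with periodicEnergy ≤ E₀^per+δ has ⟨Ψ,n₀Ψ⟩ = condensateOccupation ≥ cN. In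
THIS route it is the target decomposed by the two cruxes (StaticNoCatastrophe → RecoilBridge →
PeriodicBEC is the glue StaticFloorCondenses, with c = 1/2). (why it might fail: Box L=(N/ρ)^{1/3}→∞
at fixed ρ: every printed n₊ bound pays the box gap L² (Fournais2020 Thm 1.2; Junge2026 Cor. 6), T=0
d=3 expansions are IR-singular, hard cores are admissible and c must be uniform in N — the open
problem in its own setting.) [LiebSeiringerSolovejYngvason2005, Fournais2020, Junge2026,
ChongLiangNam2026, Literature.Barriers.AtomisticToContinuum.KineticGapLengthScales]
#2 StaticNoCatastrophe (crux) — (card S1, M = ∞ endpoint) NO ORTHOGONALITY CATASTROPHE FOR A STATIC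
SCATTERER, asymptotically complete at low density: for every repulsive finite-range v and every ε>0
there is ρ₀>0 such that for 0<ρ<ρ₀ and all large N there is δ>0 with: for all positions x, y ∈ ℝ³
and all δ-near-minimisers Φ of the N-boson periodic energy plus the pinned-scatterer term ∫Σ_j
v^per(x_j − x)|Φ|² (same coupling v as the pair interaction; torus of side L = ((N+1)/ρ)^{1/3}, the
box of the (N+1)-particle system whose tagged member is frozen) and Ψ of the same with y,
|⟨Φ,Ψ⟩_{L²(cell^N)}| ≥ 1 − ε. For true ground states this is ⟨χ^x,χ^y⟩ = Σ_P |c_P|² cos P·(y−x) ≥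
2Z₀ − 1, Z₀ = zero-momentum weight of χ^x ≥ |⟨Φ_no-scatterer, χ^x⟩|² (Anderson fidelity), so the
foreseen proof object is the fidelity of ground states of H_N and H_N + Σ_j v^per(x_j − x);
Bogoliubov: 1 − Z₀ ≍ (b/a)²√(ρa³) (b = scattering length of v, a = of v/2), finite in d = 3 only
because S(k) ≲ k/2c, log-divergent in d = 1. v ≡ 0: no scatterer either, overlap → 1 (free gap),
true. [difficulty: XL] (why it might fail: Uniform-in-N at fixed ρ is IR-bound strength: the
one-loop exponent ρ∫|v̂|²S(k)ω_k⁻²d³k is finite only via phonons (S≲k/c); the IDEAL gas has a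
bosonic OC, log Z₀≍−N^{1/3}(k_n b)² (GuentherEtAl2021 eq.3); a proof may need ω_min(k)≥c|k|
(Landau), open in the TL.) [GuentherEtAl2021, AstrakharchikPitaevskii2004, ShchadilovaEtAl2016,
GebertKuttlerMuller2014, Anderson1967, LiebSeiringerSolovejYngvason2005]
#3 RecoilBridge (crux) — (card S2 restated as smallness) RECOIL COSTS AT MOST ε: for every repulsive
finite-range v and ε>0 there is ρ₀>0 such that for 0<ρ<ρ₀ and all large N there is δ>0 such that for
every real c: IF every pair of δ-near-minimisers Φ (scatterer pinned at x) and Ψ (at y) of the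
N-boson problem of StaticNoCatastrophe has |⟨Φ,Ψ⟩| ≥ c for all x, y, THEN every δ-near-minimiser Ω
of the periodic (N+1)-boson energy on the same torus (side ((N+1)/ρ)^{1/3}) has constant-mode
occupation ⟨Ω,n₀Ω⟩ ≥ (c − ε)(N+1). Reading: n₀/(N+1) is the box average of the equal-mass tagged
affinity A^(m)(x,y) (Perron–Frobenius: the symmetric ground state is the absolute one; constant
condensate mode on the torus), the hypothesis is a floor on A^(∞); the item says A^(m) ≥ A^(∞) − ε
on average — the endpoint form of 'recoil only helps', which the 1-D data support (β_static maximal,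
Castella1996) although mass-monotonicity in between fails. Stated on the L²-robust quantity n₀
(pointwise affinity floors are false for near-minimisers: a kinetic-cheap C¹ zero at one point kills
them). v ≡ 0: both sides → 1, true; c ≤ 0: trivial. [deps: StaticNoCatastrophe] [difficulty: XL]
(why it might fail: No comparison principle behind it: in 1-D the OC exponent is non-monotone in the
probe mass (Castella1996 Fig.1; RoschKopp1995), so closeness must come from smallness of BOTH
deficits (O(√(ρa³)) at one loop); given S1 this item carries the conjunct; an O(1) recoil cost at
scales ≫ξ kills it.) [Castella1996, RoschKopp1995, GuentherEtAl2021, LampartTriay2025,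
MysliwySeiringer2020, Mcguire1965]
#4 BoundaryTransferWeak (crux) — the shared mode-free boundary-condition transfer of route
BECPeriodicReduction (stmt-0827), verbatim: for each repulsive finite-range v, PeriodicBEC(v)
implies ∃ρ₀>0 ∀ρ∈(0,ρ₀) HasGroundStateBEC v ρ (Dirichlet ground state, λ_max(γ) ≥ cN via
condensateNumber). Expected route: Neumann bracketing of interior sub-boxes (−Δ_Dir ≥ ⊕−Δ_Neu, v ≥
0) + the mode-free criterion λ_max ≥ tr γ²/N; only the ENERGY analogue is in print. [difficulty: L]
(why it might fail: PeriodicBEC(v) is ground-state-only (δ after N) at box (N/ρ)^{1/3}; the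
Dirichlet GS lies a wall term ≫δ above E₀^per and interior restrictions are neither periodic nor of
sharp N, so the hypothesis may never fire; BEC is BC-sensitive (Robinson1976). Shared with
BECPeriodicReduction (stmt-0827).) [LiebSeiringerSolovejYngvason2005, Basti2022,
BoccatoSeiringer2023, Junge2026, Robinson1976, LauwersVerbeureZagrebnov2003]
#9 StaticFloorCondenses (support) — GLUE (logic + ENNReal/filter bookkeeping): StaticNoCatastrophe →
RecoilBridge → PeriodicBEC. Fix v; take ε = 1/4 in both cruxes, ρ₀ = min, and for large N δ =
min(δ₁,δ₂) (a δ-near-minimiser is a δᵢ-near-minimiser); the static floor c = 3/4 feeds RecoilBridge,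
giving ENNReal.ofReal((1/2)(N+1)) ≤ condensateOccupation (N+1) L Ω.ψ for δ-near-minimisers Ω on the
torus of side ((N+1)/ρ)^{1/3}; shift N ↦ N+1 inside ∀ᶠ (Filter.tendsto_add_atTop_nat) to land on
PeriodicBEC's body with c = 1/2. [difficulty: provable-now] [LiebSeiringerSolovejYngvason2005 §1.2
(1.17)–(1.19), folklore]
#9 ImpurityEnergyFinite (support) — for repulsive finite-range v (range R₀) there is ρ₀>0 such that
for 0<ρ<ρ₀, all large N and EVERY scatterer position x the pinned-scatterer infimum over periodic
N-boson trial states on the torus of side ((N+1)/ρ)^{1/3} is finite: exhibit one Bose-symmetric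
Lℤ³-periodic C¹ state made of N disjoint bumps, pairwise farther than R₀ (mod L) from each other and
from x (hard cores allowed: the state vanishes where v^per = ⊤); pattern of BECPinning's
GroundStateEnergyFinite (stmt-0850) and PeriodicTrialState.const. The lemma that makes
δ-near-minimisers in StaticNoCatastrophe / RecoilBridge genuine (else every state is one).
[difficulty: provable-now] [LiebSeiringerSolovejYngvason2005 (2.3) and proof of Thm 2.2 (trial
states), folklore]

TWO-LAYER PLAN. Foreseen glued splits (k ≤ 3, depth 1; nothing filed now). StaticNoCatastrophe ⇐
AndersonFidelity → StaticNoCatastrophe, where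
AndersonFidelity(v): δ-near-minimisers of H_N (no scatterer) and of H_N + Σ_j v^per(x_j − x) have
|⟨·,·⟩| ≥ 1 − ε (glue = L² triangle
inequality, overlap ≥ 1 − 4ε). If S1 resists unconditionally: StaticNoCatastrophe ⇐ PhononLowerBound
→ FidelitySusceptibilityBound →
StaticNoCatastrophe (flow in the coupling s ∈ [0,1]; χ_F(s) = Σ_n|⟨n|V_imp|0_s⟩|²/(E_n−E₀)² ≤
ρ∫|v̂|² m₋₂(k); m₋₂ ≤ m₋₁/ω_min with the
compressibility sum rule), which would make the route CONDITIONAL on a Landau-type bound exactly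
like card landau-to-infrared-bound — to be
declared, not smuggled. RecoilBridge ⇐ MassInterpolation → RecoilBridge: a bound on the κ-derivative
(κ = m/M ∈ [0,1], H_κ = −κΔ₀ + H_bath +
Σ_j v(x_j − x₀)) of the box-averaged tagged affinity, or a Feynman–Kac comparison of a stiff versus
a free tagged world-line with a jump at
imaginary time 0 (the overlap as a quench ratio ⟨e^{−βH^x}e^{−βH^y}⟩).

KILL CRITERIA. ¬StaticNoCatastrophe — a static orthogonality catastrophe in the dilute 3-D
INTERACTING gas (overlap of the two pinned-scatterer ground
states → 0 along N at arbitrarily small ρ, e.g. ≤ exp(−cL) as for the ideal gas) — removes the M = ∞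
anchor: close `refuted:StaticNoCatastrophe`
(the conjunct survives; the line does not). ¬RecoilBridge with StaticNoCatastrophe standing is
¬PeriodicBEC in disguise: close and hand
the witness to BECPeriodicReduction (it kills the conjunct's torus form). ¬BoundaryTransferWeak:
shared fate with BECPeriodicReduction —
pivot to a Dirichlet rerun of S1/B with the √ρ̄₁ mode, not a close. PeriodicBEC proved by any other
route moots both cruxes
(close `superseded`); a refuter showing RecoilBridge ⇔ PeriodicBEC outright (S1 provable-now and
trivialising) demotes the route to a
restatement — then retire.

NOT DECOMPOSED YET. The Anderson-fidelity strengthening and the sum-rule / fidelity-susceptibility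
path to S1 (m₋₂ bounds, any Landau input); the
Feynman–Kac or κ-interpolation mechanism for B; fixed-(N, L) stability lemmas (compact resolvent,
Perron–Frobenius uniqueness, δ below the
gap ⇒ near-minimisers are e^{iθ}χ + small) used silently by both cruxes; the impurity scattering
length b (of v) versus a (of v/2)
bookkeeping; hard-core admissibility details; the N ↦ N+1 box convention. All are layer-2 children
or prover-side lemmas (`--supports`).

CHEAPEST FALSIFIER. One loop, done by hand at filing: with Bogoliubov S(k) = ε_k/ω_k the static
fidelity exponent is −log Z₀ = n∫d³k(2π)⁻³|Û_k|²ε_k/ω_k³ =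
(2n/π²)∫Û_k² k dk (k² + 16πan)^{−3/2} ≈ C(b/a)²√(ρa³), C = O(1) (GuentherEtAl2021 eq. (14): log Z =
−√2πnξb²) — FINITE and → 0 as ρ → 0, so
S1 passes at one loop, and the static floor 1 − 2C(b/a)²√(ρa³) lies BELOW the Bogoliubov n₀/N = 1 −
1.505√(ρa³) for b ≥ a, so B passes with
room. The decisive cheap kill is numerical: PIGS/DMC for hard spheres at ρa³ = 10⁻³ with one pinned
sphere, overlap of the ground states with
the sphere at x and at x + (L/2)e₁ for N = 64 … 1024 (ratio estimator) — saturation near 1 −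
O(√(ρa³)) keeps S1, decay in N kills it. Lookup
already run: no rigorous static-impurity (no-)catastrophe theorem for interacting bosons exists
(zbMATH 'orthogonality catastrophe': fermionic
only, GebertKuttlerMuller2014, Küttler–Otte–Spitzer arXiv:1301.4923).

NUMBERS. Bogoliubov depletion 1 − n₀/N = (8/3√π)√(ρa³) ≈ 1.505√(ρa³)
(LiebSeiringerSolovejYngvason2005 App. A / LHY). Static deficit, interacting bath:
log Z = −√2 π n ξ b², ξ = (8πna)^{−1/2}, i.e. 1 − Z ≍ (b/a)²√(ρa³) (GuentherEtAl2021 eq. (14); this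
route's one-loop constant 2/√π vs √π/2
is convention). Ideal bath: Z₀ = [1 − α(k_n b)²/(2N^{2/3})]^{2N} ≈ exp(−αN^{1/3}(k_n b)²)
(GuentherEtAl2021 eq. (3)) — the catastrophe S1 must
beat using repulsion. 1-D calibration: β(t_h = 0⁺) = β_static/2 perturbatively, rising back to
β_static at strong coupling as the impurity
lightens (Castella1996 Fig. 1; RoschKopp1995: ratio 1/4 at half filling) — non-monotone in M,
endpoint-ordered. Items at open: 7 (1 target
shared, 3 cruxes of which 1 shared, 2 support, 1 assembly).

DEFINITION REQUESTS. None blocking: the pinned-scatterer energy is inlined (periodicEnergy v Φ +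
∫⁻_{cell^N} (Σ_j periodizedPotential v L (X j − x))·‖Φ‖²) and its
ground-state energy is the inline ⨅ over PeriodicTrialState N L. Nice-to-have (would shorten every
statement of this route and serve the
impurity/polaron cards one-particle-at-a-time, kv-insertion-corrector,
frozen-bath-anderson-endpoint): `impurityPeriodicEnergy v L x Φ` and
`impurityGroundStateEnergy v N L x` in
Literature/MathematicalPhysics/QuantumManyBody/PeriodicBoseGas — to be requested with
`ledger workitem add --kind definition` once the route id exists.

Novelty: Searches (2026-08-15): `lit frontier AtomisticToContinuum --since 2020` (30 rows; BEC descendants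
arXiv:2603.20776, arXiv:2510.20493,
arXiv:2602.16566 — none on impurities/overlaps); `lit bridges AtomisticToContinuum --cross any` (30
rows, no impurity/OC bridge);
`lit search --source crossref "orthogonality catastrophe impurity Bose-Einstein condensate"` (15:
GuentherEtAl2021 =
doi:10.1103/physreva.103.013317, doi:10.1103/physreva.63.013609 Kuklov–Birman,
AstrakharchikPitaevskii2004); `lit search --source zbmath
"orthogonality catastrophe"` (19: all fermionic/rigorous-fermionic — GebertKuttlerMuller2014,
arXiv:1301.4923, arXiv:1409.1206 Frank–Pushnitski);
`lit search --source zbmath "impurity dilute Bose gas ground state Bogoliubov Fröhlich rigorous"`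
(1: LampartTriay2025 = arXiv:2411.11655);
`lit search --source crossref "ideal Bose polaron orthogonality catastrophe Drescher Salmhofer
Enss"` (doi:10.1103/physreva.103.033317 etc.,
ideal-bath dynamics); `lit search --hybrid` local books (Pethick–Smith, Griffin1995 volume, Zhai
2021: textbook polaron/impurity pages, no
mass flow); `lit galaxy search "orthogonality catastrophe" --star all` (31 rows:
X-ray-edge/Kondo/Luttinger books and papers, Lampart's
renormalised Bogoliubov–Fröhlich pdf arXiv:1909.02430); `lit galaxy search "infinitely heavy
impurity" --star pdf` (2: Christianen thesis);
`lit read arXiv:2004.07166` pp. 1–3 (eqs. (1)–(3), (13)–(15) quoted above); the card's audit-15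
priors Castella1996, RoschKopp1995.
Nearest  [refs: 10.1103/physreva.103.013317, 10.1103/physreva.63.013609, 10.1103/physreva.103.033317, 2603.20776, 2510.20493, 2602.16566, 1301.4923, 1409.1206, 2411.11655, 1909.02430, 2004.07166, 1302.6124, doi:10.1103/physreva.103.013317, doi:10.1103/physreva.63.013609, doi:10.1103/physreva.103.033317, GuentherEtAl2021, AstrakharchikPitaevskii2004, GebertKuttlerMuller2014, LampartTriay2025, Castella1996, RoschKo]

Barriers (technique_class: impurity-mass-deformation, orthogonality-overlap): - technique_class: impurity-mass-deformation, orthogonality-overlap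
- Literature.Barriers.AtomisticToContinuum.KineticGapLengthScales: evaded in the statements — no
energy window argument, no box gap: S1 and B are overlap/occupation floors for near-minimisers with
δ chosen AFTER N (δ below the fixed-N gap is stability, not the mechanism); honest: an unconditional
proof of S1 through the fidelity susceptibility wants ω_min(k) ≥ c|k|, a Landau-type input of the
same strength as the infrared bound — if that is the only way, the route declares itself conditional
(Two-layer plan).
- Literature.Barriers.AtomisticToContinuum.BogoliubovPerturbationInfrared: the static exponent is a
one-loop functional of the DENSITY sector (∫|v̂|²S/ω²), gauge-invariant and IR-finite in d = 3 per
the entry's own narrowed scope; no anomalous propagator is formed and B is non-perturbative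
closeness, not a series; honest: going beyond one loop for the fidelity by expanding around
Bogoliubov would meet the complex-measure problem — the bet is Feynman–Kac/positivity of two
POSITIVE ground states instead.
- Literature.Barriers.AtomisticToContinuum.EnergyAsymptoticsWithoutCondensation: respected — no
energy asymptotics are matched; energies enter only as near-minimiser slack and inside fidelity
susceptibilities of a perturbed family (the entry's evasion (ii)); the 1-D Lieb–Liniger witness has
a log-divergent static exponent, so S1 is false there as it must be.
- Literature.Barriers.AtomisticToContinuum.Pitae

History (route lifecycle, newest last):
- 2026-08-15T13:39:02Z · CLOSED retired — not-a-thesis: assembly does not conclude the sub-problem Statement (operator:999:1257524)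

sub-problem: BoseEinsteinCondensation · status: closed(retired) · opened planner-plancard-AtomisticToContinuum-BoseEin-9696e406-0 2026-08-15T11:26:01Z · rev 0 · ledger route-AtomisticToContinuum-BECImpurityMassFlow
GENERATED by the gate from the ledger (D-0016/17). Provers cite these decls: `theorem foo : Summit.AtomisticToContinuum.BoseEinsteinCondensation.Theses.BECImpurityMassFlow.<Decl> := …` in Summits/AtomisticToContinuum/BoseEinsteinCondensation/Theorems/<Name>.lean.
-/

namespace Summit.AtomisticToContinuum.BoseEinsteinCondensation.Theses.BECImpurityMassFlow

open scoped BigOperators Topology Manifold Classical MeasureTheory ProbabilityTheory Matrix InnerProductSpace ComplexConjugate ContinuousMap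
open Filter Set Function TopologicalSpace MeasureTheory

attribute [summit_statement] _root_.BoseEinsteinCondensation

/-- item stmt-AtomisticToContinuum-0826 · target · rank 0 · closed · moot by None · by planner
why it might fail: Box L=(N/ρ)^{1/3}→∞ at fixed ρ: every printed n₊ bound pays the box gap L² (Fournais2020 Thm 1.2; Junge2026 Cor. 6), T=0 d=3 expansions are IR-singular, hard cores are admissible and c must be uniform in N — the open problem in its own setting.
sources: LiebSeiringerSolovejYngvason2005, Fournais2020, Junge2026, ChongLiangNam2026, Literature.Barriers.AtomisticToContinuum.KineticGapLengthScales
[crux] PeriodicBEC: for every repulsive finite-range radial v there is ρ₀>0 such that for 0<ρ<ρ₀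
there is c>0 with: for all large N there is δ>0 such that every PERIODIC trial state Ψ on the torus
of side L=(N/ρ)^{1/3} with periodicEnergy ≤ E₀^per(N,L)+δ has constant-mode occupation ⟨Ψ,n₀Ψ⟩ =
condensateOccupation N L Ψ ≥ cN. The open problem in the literature's own (translation-invariant)
setting; Fournais2020 Thm 1.2 gives it on scales L ≤ C(ρa³)^{-δ}(ρa)^{-1/2}, Junge2026 Cor. 6
(Neumann) up to a(ρa³)^{-3/4-η}. Sources: LiebSeiringerSolovejYngvason2005 Ch. 5; Fournais2020;
Junge2026; ChongLiangNam2026. -/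
@[route_item "route-AtomisticToContinuum-BECImpurityMassFlow"]
def PeriodicBEC : Prop :=
  ∀ v : ℝ → ENNReal, Literature.MathematicalPhysics.QuantumManyBody.BoseGas.IsRepulsiveFiniteRange v → ∃ ρ₀ : ℝ, 0 < ρ₀ ∧ ∀ ρ : ℝ, 0 < ρ → ρ < ρ₀ → ∃ c : ℝ, 0 < c ∧ ∀ᶠ N : ℕ in Filter.atTop, ∃ δ : ENNReal, 0 < δ ∧ ∀ Ψ : Literature.MathematicalPhysics.QuantumManyBody.BoseGas.PeriodicTrialState N (Literature.MathematicalPhysics.QuantumManyBody.BoseGas.sideLength ρ N), Literature.MathematicalPhysics.QuantumManyBody.BoseGas.periodicEnergy v Ψ ≤ Literature.MathematicalPhysics.QuantumManyBody.BoseGas.periodicGroundStateEnergy v N (Literature.MathematicalPhysics.QuantumManyBody.BoseGas.sideLength ρ N) + δ → ENNReal.ofReal (c * N) ≤ Literature.MathematicalPhysics.QuantumManyBody.BoseGas.condensateOccupation N (Literature.MathematicalPhysics.QuantumManyBody.BoseGas.sideLength ρ N) Ψ.ψ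

/-- item stmt-AtomisticToContinuum-3906 · crux · rank 2 · closed · moot by None · by planner
why it might fail: Uniform-in-N at fixed ρ is IR-bound strength: the one-loop exponent ρ∫|v̂|²S(k)ω_k⁻²d³k is finite only via phonons (S≲k/c); the IDEAL gas has a bosonic OC, log Z₀≍−N^{1/3}(k_n b)² (GuentherEtAl2021 eq.3); a proof may need ω_min(k)≥c|k| (Landau), open in the TL.
sources: GuentherEtAl2021, AstrakharchikPitaevskii2004, ShchadilovaEtAl2016, GebertKuttlerMuller2014, Anderson1967, LiebSeiringerSolovejYngvason2005
[crux] (card S1, M = ∞ endpoint) NO ORTHOGONALITY CATASTROPHE FOR A STATIC SCATTERER, asymptotically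
complete at low density: for every repulsive finite-range v and every ε>0 there is ρ₀>0 such that
for 0<ρ<ρ₀ and all large N there is δ>0 with: for all positions x, y ∈ ℝ³ and all δ-near-minimisers
Φ of the N-boson periodic energy plus the pinned-scatterer term ∫Σ_j v^per(x_j − x)|Φ|² (same
coupling v as the pair interaction; torus of side L = ((N+1)/ρ)^{1/3}, the box of the (N+1)-particle
system whose tagged member is frozen) and Ψ of the same with y, |⟨Φ,Ψ⟩_{L²(cell^N)}| ≥ 1 − ε. For
true ground states this is ⟨χ^x,χ^y⟩ = Σ_P |c_P|² cos P·(y−x) ≥ 2Z₀ − 1, Z₀ = zero-momentum weight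
of χ^x ≥ |⟨Φ_no-scatterer, χ^x⟩|² (Anderson fidelity), so the foreseen proof object is the fidelity
of ground states of H_N and H_N + Σ_j v^per(x_j − x); Bogoliubov: 1 − Z₀ ≍ (b/a)²√(ρa³) (b =
scattering length of v, a = of v/2), finite in d = 3 only because S(k) ≲ k/2c, log-divergent in d =
1. v ≡ 0: no scatterer either, overlap → 1 (free gap), true. [difficulty: XL] -/
@[route_item "route-AtomisticToContinuum-BECImpurityMassFlow"]
def StaticNoCatastrophe : Prop :=
  ∀ v : ℝ → ENNReal, Literature.MathematicalPhysics.QuantumManyBody.BoseGas.IsRepulsiveFiniteRange v → ∀ ε : ℝ, 0 < ε → ∃ ρ₀ : ℝ, 0 < ρ₀ ∧ ∀ ρ : ℝ, 0 < ρ → ρ < ρ₀ → ∀ᶠ N : ℕ in Filter.atTop, ∃ δ : ENNReal, 0 < δ ∧ ∀ (x y : Literature.MathematicalPhysics.QuantumManyBody.BoseGas.Space) (Φ Ψ : Literature.MathematicalPhysics.QuantumManyBody.BoseGas.PeriodicTrialState N (Literature.MathematicalPhysics.QuantumManyBody.BoseGas.sideLength ρ (N + 1))), (Literature.MathematicalPhysics.QuantumManyBody.BoseGas.periodicEnergy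 v Φ + ∫⁻ X in Literature.MathematicalPhysics.QuantumManyBody.BoseGas.cellN N (Literature.MathematicalPhysics.QuantumManyBody.BoseGas.sideLength ρ (N + 1)), (∑ j : Fin N, Literature.MathematicalPhysics.QuantumManyBody.BoseGas.periodizedPotential v (Literature.MathematicalPhysics.QuantumManyBody.BoseGas.sideLength ρ (N + 1)) (X j - x)) * (‖Φ.ψ X‖₊ : ENNReal) ^ 2) ≤ (⨅ Θ : Literature.MathematicalPhysics.QuantumManyBody.BoseGas.PeriodicTrialState N (Literature.MathematicalPhysics.QuantumManyBody.BoseGas.sideLength ρ (N + 1)), (Literature.MathematicalPhysics.QuantumManyBody.BoseGas.periodicEnergy v Θ + ∫⁻ X in Literature.MathematicalPhysics.QuantumManyBody.BoseGas.cellN N (Literature.MathematicalPhysics.QuantumManyBody.BoseGas.sideLength ρ (N + 1)), (∑ j : Fin N, Literature.MathematicalPhysics.QuantumManyBody.BoseGas.periodizedPotential v (Literature.MathematicalPhysics.QuantumManyBody.BoseGas.sideLength ρ (N + 1)) (X j - x)) * (‖Θ.ψ X‖₊ : ENNReal) ^ 2)) + δ → (Literature.MathematicalPhysics.QuantumManyBody.BoseGas.periodicEnergy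 v Ψ + ∫⁻ X in Literature.MathematicalPhysics.QuantumManyBody.BoseGas.cellN N (Literature.MathematicalPhysics.QuantumManyBody.BoseGas.sideLength ρ (N + 1)), (∑ j : Fin N, Literature.MathematicalPhysics.QuantumManyBody.BoseGas.periodizedPotential v (Literature.MathematicalPhysics.QuantumManyBody.BoseGas.sideLength ρ (N + 1)) (X j - y)) * (‖Ψ.ψ X‖₊ : ENNReal) ^ 2) ≤ (⨅ Θ : Literature.MathematicalPhysics.QuantumManyBody.BoseGas.PeriodicTrialState N (Literature.MathematicalPhysics.QuantumManyBody.BoseGas.sideLength ρ (N + 1)), (Literature.MathematicalPhysics.QuantumManyBody.BoseGas.periodicEnergy v Θ + ∫⁻ X in Literature.MathematicalPhysics.QuantumManyBody.BoseGas.cellN N (Literature.MathematicalPhysics.QuantumManyBody.BoseGas.sideLength ρ (N + 1)), (∑ j : Fin N, Literature.MathematicalPhysics.QuantumManyBody.BoseGas.periodizedPotential v (Literature.MathematicalPhysics.QuantumManyBody.BoseGas.sideLength ρ (N + 1)) (X j - y)) * (‖Θ.ψ X‖₊ : ENNReal) ^ 2)) + δ → 1 - ε ≤ ‖∫ X in Literature.MathematicalPhysics.QuantumManyBody.BoseGas.cellN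 N (Literature.MathematicalPhysics.QuantumManyBody.BoseGas.sideLength ρ (N + 1)), conj (Φ.ψ X) * Ψ.ψ X‖

/-- item stmt-AtomisticToContinuum-3907 · crux · rank 3 · closed · moot by None · by planner
why it might fail: No comparison principle behind it: in 1-D the OC exponent is non-monotone in the probe mass (Castella1996 Fig.1; RoschKopp1995), so closeness must come from smallness of BOTH deficits (O(√(ρa³)) at one loop); given S1 this item carries the conjunct; an O(1) recoil cost at scales ≫ξ kills it.
sources: Castella1996, RoschKopp1995, GuentherEtAl2021, LampartTriay2025, MysliwySeiringer2020, Mcguire1965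
[crux] (card S2 restated as smallness) RECOIL COSTS AT MOST ε: for every repulsive finite-range v
and ε>0 there is ρ₀>0 such that for 0<ρ<ρ₀ and all large N there is δ>0 such that for every real c:
IF every pair of δ-near-minimisers Φ (scatterer pinned at x) and Ψ (at y) of the N-boson problem of
StaticNoCatastrophe has |⟨Φ,Ψ⟩| ≥ c for all x, y, THEN every δ-near-minimiser Ω of the periodic
(N+1)-boson energy on the same torus (side ((N+1)/ρ)^{1/3}) has constant-mode occupation ⟨Ω,n₀Ω⟩ ≥
(c − ε)(N+1). Reading: n₀/(N+1) is the box average of the equal-mass tagged affinity A^(m)(x,y)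
(Perron–Frobenius: the symmetric ground state is the absolute one; constant condensate mode on the
torus), the hypothesis is a floor on A^(∞); the item says A^(m) ≥ A^(∞) − ε on average — the
endpoint form of 'recoil only helps', which the 1-D data support (β_static maximal, Castella1996)
although mass-monotonicity in between fails. Stated on the L²-robust quantity n₀ (pointwise affinity
floors are false for near-minimisers: a kinetic-cheap C¹ zero at one point kills them). v ≡ 0: both
sides → 1, true; c ≤ 0: trivial. [deps: StaticNoCatastrophe] [difficulty: XL] -/
@[route_item "route-AtomisticToContinuum-BECImpurityMassFlow"]
def RecoilBridge : Prop :=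
  ∀ v : ℝ → ENNReal, Literature.MathematicalPhysics.QuantumManyBody.BoseGas.IsRepulsiveFiniteRange v → ∀ ε : ℝ, 0 < ε → ∃ ρ₀ : ℝ, 0 < ρ₀ ∧ ∀ ρ : ℝ, 0 < ρ → ρ < ρ₀ → ∀ᶠ N : ℕ in Filter.atTop, ∃ δ : ENNReal, 0 < δ ∧ ∀ c : ℝ, (∀ (x y : Literature.MathematicalPhysics.QuantumManyBody.BoseGas.Space) (Φ Ψ : Literature.MathematicalPhysics.QuantumManyBody.BoseGas.PeriodicTrialState N (Literature.MathematicalPhysics.QuantumManyBody.BoseGas.sideLength ρ (N + 1))), (Literature.MathematicalPhysics.QuantumManyBody.BoseGas.periodicEnergy v Φ + ∫⁻ X in Literature.MathematicalPhysics.QuantumManyBody.BoseGas.cellN N (Literature.MathematicalPhysics.QuantumManyBody.BoseGas.sideLength ρ (N + 1)), (∑ j : Fin N, Literature.MathematicalPhysics.QuantumManyBody.BoseGas.periodizedPotential v (Literature.MathematicalPhysics.QuantumManyBody.BoseGas.sideLength ρ (N + 1)) (X j - x)) * (‖Φ.ψ X‖₊ : ENNReal) ^ 2) ≤ (⨅ Θ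 : Literature.MathematicalPhysics.QuantumManyBody.BoseGas.PeriodicTrialState N (Literature.MathematicalPhysics.QuantumManyBody.BoseGas.sideLength ρ (N + 1)), (Literature.MathematicalPhysics.QuantumManyBody.BoseGas.periodicEnergy v Θ + ∫⁻ X in Literature.MathematicalPhysics.QuantumManyBody.BoseGas.cellN N (Literature.MathematicalPhysics.QuantumManyBody.BoseGas.sideLength ρ (N + 1)), (∑ j : Fin N, Literature.MathematicalPhysics.QuantumManyBody.BoseGas.periodizedPotential v (Literature.MathematicalPhysics.QuantumManyBody.BoseGas.sideLength ρ (N + 1)) (X j - x)) * (‖Θ.ψ X‖₊ : ENNReal) ^ 2)) + δ → (Literature.MathematicalPhysics.QuantumManyBody.BoseGas.periodicEnergy v Ψ + ∫⁻ X in Literature.MathematicalPhysics.QuantumManyBody.BoseGas.cellN N (Literature.MathematicalPhysics.QuantumManyBody.BoseGas.sideLength ρ (N + 1)), (∑ j : Fin N, Literature.MathematicalPhysics.QuantumManyBody.BoseGas.periodizedPotential v (Literature.MathematicalPhysics.QuantumManyBody.BoseGas.sideLength ρ (N + 1)) (X j - y)) * (‖Ψ.ψ X‖₊ : ENNReal)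 ^ 2) ≤ (⨅ Θ : Literature.MathematicalPhysics.QuantumManyBody.BoseGas.PeriodicTrialState N (Literature.MathematicalPhysics.QuantumManyBody.BoseGas.sideLength ρ (N + 1)), (Literature.MathematicalPhysics.QuantumManyBody.BoseGas.periodicEnergy v Θ + ∫⁻ X in Literature.MathematicalPhysics.QuantumManyBody.BoseGas.cellN N (Literature.MathematicalPhysics.QuantumManyBody.BoseGas.sideLength ρ (N + 1)), (∑ j : Fin N, Literature.MathematicalPhysics.QuantumManyBody.BoseGas.periodizedPotential v (Literature.MathematicalPhysics.QuantumManyBody.BoseGas.sideLength ρ (N + 1)) (X j - y)) * (‖Θ.ψ X‖₊ : ENNReal) ^ 2)) + δ → c ≤ ‖∫ X in Literature.MathematicalPhysics.QuantumManyBody.BoseGas.cellN N (Literature.MathematicalPhysics.QuantumManyBody.BoseGas.sideLength ρ (N + 1)), conj (Φ.ψ X) * Ψ.ψ X‖) → ∀ Ω : Literature.MathematicalPhysics.QuantumManyBody.BoseGas.PeriodicTrialState (N + 1) (Literature.MathematicalPhysics.QuantumManyBody.BoseGas.sideLength ρ (N + 1)), Literature.MathematicalPhysics.QuantumManyBody.BoseGas.periodicEnergy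 v Ω ≤ Literature.MathematicalPhysics.QuantumManyBody.BoseGas.periodicGroundStateEnergy v (N + 1) (Literature.MathematicalPhysics.QuantumManyBody.BoseGas.sideLength ρ (N + 1)) + δ → ENNReal.ofReal ((c - ε) * (N + 1)) ≤ Literature.MathematicalPhysics.QuantumManyBody.BoseGas.condensateOccupation (N + 1) (Literature.MathematicalPhysics.QuantumManyBody.BoseGas.sideLength ρ (N + 1)) Ω.ψ

/-- item stmt-AtomisticToContinuum-0827 · crux · rank 4 · open · by planner
why it might fail: PeriodicBEC(v) is ground-state-only (δ after N) at box (N/ρ)^{1/3}; the Dirichlet GS lies a wall term ≫δ above E₀^per and interior restrictions are neither periodic nor of sharp N, so the hypothesis may never fire; BEC is BC-sensitive (Robinson1976). Shared with BECPeriodicReduction (stmt-0827).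
sources: LiebSeiringerSolovejYngvason2005, Basti2022, BoccatoSeiringer2023, Junge2026, Robinson1976, LauwersVerbeureZagrebnov2003
[crux] BoundaryTransferWeak (mode-free boundary-condition transfer, per potential): for each
repulsive finite-range v, PeriodicBEC(v) implies ∃ρ₀>0 ∀ρ∈(0,ρ₀) HasGroundStateBEC v ρ (Dirichlet
ground state, λ_max(γ) ≥ cN via condensateNumber). Not glue: near-minimiser slacks are O(N/L²) while
Dirichlet/periodic energies differ by a boundary term ≫ N/L², so no energy-comparison proof;
expected route: Neumann bracketing of interior sub-boxes (−Δ_Dir ≥ ⊕−Δ_Neu, v ≥ 0) + a mode-free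
criterion (λ_max ≥ tr γ²/N). Only the ENERGY analogue is in print (LiebSeiringerSolovejYngvason2005
Ch. 2 after (2.8)). v ≡ 0: hypothesis and conclusion both true. -/
@[route_item "route-AtomisticToContinuum-BECImpurityMassFlow"]
def BoundaryTransferWeak : Prop :=
  ∀ v : ℝ → ENNReal, Literature.MathematicalPhysics.QuantumManyBody.BoseGas.IsRepulsiveFiniteRange v → (∃ ρ₀ : ℝ, 0 < ρ₀ ∧ ∀ ρ : ℝ, 0 < ρ → ρ < ρ₀ → ∃ c : ℝ, 0 < c ∧ ∀ᶠ N : ℕ in Filter.atTop, ∃ δ : ENNReal, 0 < δ ∧ ∀ Ψ : Literature.MathematicalPhysics.QuantumManyBody.BoseGas.PeriodicTrialState N (Literature.MathematicalPhysics.QuantumManyBody.BoseGas.sideLength ρ N), Literature.MathematicalPhysics.QuantumManyBody.BoseGas.periodicEnergy v Ψ ≤ Literature.MathematicalPhysics.QuantumManyBody.BoseGas.periodicGroundStateEnergy v N (Literature.MathematicalPhysics.QuantumManyBody.BoseGas.sideLength ρ N) + δ → ENNReal.ofReal (c * N) ≤ Literature.MathematicalPhysics.QuantumManyBody.BoseGas.condensateOccupation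 N (Literature.MathematicalPhysics.QuantumManyBody.BoseGas.sideLength ρ N) Ψ.ψ) → ∃ ρ₀ : ℝ, 0 < ρ₀ ∧ ∀ ρ : ℝ, 0 < ρ → ρ < ρ₀ → Literature.MathematicalPhysics.QuantumManyBody.BoseGas.HasGroundStateBEC v ρ

/-- item stmt-AtomisticToContinuum-3908 · support · rank 9 · closed · moot by None · by planner
sources: LiebSeiringerSolovejYngvason2005 §1.2 (1.17)–(1.19), folklore
[support] GLUE (logic + ENNReal/filter bookkeeping): StaticNoCatastrophe → RecoilBridge →
PeriodicBEC. Fix v; take ε = 1/4 in both cruxes, ρ₀ = min, and for large N δ = min(δ₁,δ₂) (a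
δ-near-minimiser is a δᵢ-near-minimiser); the static floor c = 3/4 feeds RecoilBridge, giving
ENNReal.ofReal((1/2)(N+1)) ≤ condensateOccupation (N+1) L Ω.ψ for δ-near-minimisers Ω on the torus
of side ((N+1)/ρ)^{1/3}; shift N ↦ N+1 inside ∀ᶠ (Filter.tendsto_add_atTop_nat) to land on
PeriodicBEC's body with c = 1/2. [difficulty: provable-now] -/
@[route_item "route-AtomisticToContinuum-BECImpurityMassFlow"]
def StaticFloorCondenses : Prop :=
  StaticNoCatastrophe → RecoilBridge → PeriodicBEC

/-- item stmt-AtomisticToContinuum-3909 · support · rank 9 · closed · moot by None · by planner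
sources: LiebSeiringerSolovejYngvason2005 (2.3) and proof of Thm 2.2 (trial states), folklore
[support] for repulsive finite-range v (range R₀) there is ρ₀>0 such that for 0<ρ<ρ₀, all large N
and EVERY scatterer position x the pinned-scatterer infimum over periodic N-boson trial states on
the torus of side ((N+1)/ρ)^{1/3} is finite: exhibit one Bose-symmetric Lℤ³-periodic C¹ state made
of N disjoint bumps, pairwise farther than R₀ (mod L) from each other and from x (hard cores
allowed: the state vanishes where v^per = ⊤); pattern of BECPinning's GroundStateEnergyFinite
(stmt-0850) and PeriodicTrialState.const. The lemma that makes δ-near-minimisers in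
StaticNoCatastrophe / RecoilBridge genuine (else every state is one). [difficulty: provable-now] -/
@[route_item "route-AtomisticToContinuum-BECImpurityMassFlow"]
def ImpurityEnergyFinite : Prop :=
  ∀ v : ℝ → ENNReal, Literature.MathematicalPhysics.QuantumManyBody.BoseGas.IsRepulsiveFiniteRange v → ∃ ρ₀ : ℝ, 0 < ρ₀ ∧ ∀ ρ : ℝ, 0 < ρ → ρ < ρ₀ → ∀ᶠ N : ℕ in Filter.atTop, ∀ x : Literature.MathematicalPhysics.QuantumManyBody.BoseGas.Space, (⨅ Θ : Literature.MathematicalPhysics.QuantumManyBody.BoseGas.PeriodicTrialState N (Literature.MathematicalPhysics.QuantumManyBody.BoseGas.sideLength ρ (N + 1)), (Literature.MathematicalPhysics.QuantumManyBody.BoseGas.periodicEnergy v Θ + ∫⁻ X in Literature.MathematicalPhysics.QuantumManyBody.BoseGas.cellN N (Literature.MathematicalPhysics.QuantumManyBody.BoseGas.sideLength ρ (N + 1)), (∑ j : Fin N, Literature.MathematicalPhysics.QuantumManyBody.BoseGas.periodizedPotential v (Literature.MathematicalPhysics.QuantumManyBody.BoseGas.sideLength ρ (N + 1)) (X j - x))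 * (‖Θ.ψ X‖₊ : ENNReal) ^ 2)) ≠ ⊤

/-- item stmt-AtomisticToContinuum-3910 · assembly · rank 1 · closed · moot by None · by planner
sources: LiebSeiringerSolovejYngvason2005
[assembly] StaticNoCatastrophe → RecoilBridge → StaticFloorCondenses → BoundaryTransferWeak →
BoseEinsteinCondensation (the conjunct). -/
@[route_item "route-AtomisticToContinuum-BECImpurityMassFlow"]
def Assembly : Prop :=
  StaticNoCatastrophe → RecoilBridge → StaticFloorCondenses → BoundaryTransferWeak → Literature.MathematicalPhysics.QuantumManyBody.BoseGas.BoseEinsteinCondensation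

end Summit.AtomisticToContinuum.BoseEinsteinCondensation.Theses.BECImpurityMassFlow
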